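/-
Copyright (c) 2026. All rights reserved.
Released under Apache 2.0 license as described in the file LICENSE.
-/
import Literature.GroupTheory.ProcyclicModNormalOpen
import Literature.AnabelianGeometry.AbsoluteAnabelian.AbsTopIII.KummerFaithfulCyclotomicProofs
import Mathlib.Topology.Algebra.ContinuousMonoidHom
import HarnessLib

/-!
# The kernel of a `ℤ_p`-valued character of a "procyclic modulo a normal subgroup" compact group is
# topologically generated, modulo its inertia part, by a power of the generator

Let `G` be a compact topological group, `N ⊴ G` a closed normal subgroup and `t ∈ G` with
`⟨t⟩ N` dense in `G` (so `G ⧸ N` is procyclic, topologically generated by the image of `t`; the model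
is a local absolute Galois group `Γ_F`, its inertia group `I_F` and an arithmetic Frobenius `t`).  Let
`λ : G →ₜ* ℤ_p` be a continuous additive character which is NON-TRIVIAL on `N` ("ramified").  We prove
(`exists_ker_le_topologicalClosure_zpowers_sup_inf`):

  there are `m ≥ 1`, `ι ∈ N` and `φ := t ^ m ι⁻¹ ∈ ker λ` such that
  `ker λ ⊆ cl(⟨φ⟩ · (ker λ ∩ N))`,

i.e. the closed subgroup `H = ker λ` (whose quotient `H/(H ∩ N)` is the open subgroup of `G ⧸ N` of
index `m = [λ(G) : λ(N)]`) is topologically generated by `φ` modulo `H ∩ N`.  Classically: an open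
subgroup of index `m` of a procyclic group `cl⟨t̄⟩` is `cl⟨t̄ ^ m⟩` (Ribes–Zalesskii, *Profinite
Groups*, §2.7; the tree's `Literature.GroupTheory.exists_pow_mem_closure_inter_eq`, stated modulo `N`
inside `G`), applied to the open subgroup `λ⁻¹(λ(N)) = H N` — `λ(N)` is a non-zero closed subgroup of
`ℤ_p`, hence open (the tree's `PadicInt.isOpen_of_isClosed_addSubgroup`) — followed by the elementary
compactness step `le_topologicalClosure_zpowers_sup_inf` (`cl(⟨φ⟩N) ⊆ cl⟨φ⟩ · N` for compact `N`, so an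
element `x` of the closed subgroup `H ∋ φ` factors as `x = y n` with `y ∈ cl⟨φ⟩ ⊆ H` and then
`n ∈ H ∩ N`).  For `G = Γ_{F}` (`F` a `2`-adic field), `N = I_F`, this is the statement
"`Gal(F̄/F_∞^{ac})∩D` is topologically generated by a Frobenius power modulo its inertia subgroup"
consumed by the BSD cell `bsd-2adic` (crux `BDPSelmerLowerDivisibilityAtTwo`).
[cite: RibesZalesskii2010, §2.7] [cite: NeukirchSchmidtWingberg2008, Thm. 7.5.3]
Mathlib + tree only; THEOREMS ONLY (no definition, no named fact, no instance).
-/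

namespace Literature.GroupTheory

open scoped Pointwise

variable {G : Type*} [Group G] [TopologicalSpace G] [IsTopologicalGroup G]

/-- **Compactness step.** Let `N ⊴ G` be a COMPACT normal subgroup, `H ≤ G` a CLOSED subgroup and
`φ ∈ H` with `H ⊆ cl(⟨φ⟩ N)`.  Then `H ⊆ cl(⟨φ⟩ (H ∩ N))`: indeed `cl(⟨φ⟩ N) ⊆ cl⟨φ⟩ · N` (a closed
set times a compact set is closed), so `x ∈ H` is `y n` with `y ∈ cl⟨φ⟩ ⊆ H`, whence
`n = y⁻¹ x ∈ H ∩ N`. [cite: RibesZalesskii2010, §2.7] -/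
theorem le_topologicalClosure_zpowers_sup_inf (N : Subgroup G) [N.Normal] (hN : IsCompact (N : Set G))
    (H : Subgroup G) (hH : IsClosed (H : Set G)) {φ : G} (hφ : φ ∈ H)
    (hle : (H : Set G) ⊆ closure ((Subgroup.zpowers φ ⊔ N : Subgroup G) : Set G)) :
    H ≤ (Subgroup.zpowers φ ⊔ (H ⊓ N)).topologicalClosure := by
  intro x hx
  -- `cl(⟨φ⟩ N) ⊆ cl⟨φ⟩ · N`
  have hZc : IsClosed (((Subgroup.zpowers φ).topologicalClosure : Subgroup G) : Set G) :=
    (Subgroup.zpowers φ).isClosed_topologicalClosure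
  have hprod : IsClosed ((((Subgroup.zpowers φ).topologicalClosure : Subgroup G) : Set G) * (N : Set G)) :=
    IsClosed.mul_right_of_isCompact hZc hN
  have hsub : closure ((Subgroup.zpowers φ ⊔ N : Subgroup G) : Set G) ⊆
      (((Subgroup.zpowers φ).topologicalClosure : Subgroup G) : Set G) * (N : Set G) := by
    refine closure_minimal ?_ hprod
    rw [Subgroup.mul_normal]
    exact Set.mul_subset_mul_right (Subgroup.zpowers φ).le_topologicalClosure
  obtain ⟨y, hy, n, hn, rfl⟩ := Set.mem_mul.mp (hsub (hle hx))
  -- `y ∈ H` since `cl⟨φ⟩ ⊆ H`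
  have hZH : (Subgroup.zpowers φ).topologicalClosure ≤ H :=
    Subgroup.topologicalClosure_minimal _ ((Subgroup.zpowers_le).2 hφ) hH
  have hyH : y ∈ H := hZH hy
  have hnH : n ∈ H := by
    have : n = y⁻¹ * (y * n) := by group
    rw [this]
    exact H.mul_mem (H.inv_mem hyH) hx
  -- conclude
  refine Subgroup.mul_mem _ ?_ ?_
  · exact Subgroup.topologicalClosure_mono (le_sup_left) hy
  · exact (Subgroup.zpowers φ ⊔ (H ⊓ N)).le_topologicalClosure
      (Subgroup.mem_sup_right (Subgroup.mem_inf.2 ⟨hnH, hn⟩))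

variable [CompactSpace G]

/-- **The kernel of a ramified `ℤ_p`-character of a procyclic-mod-`N` compact group is topologically
generated by a power of the generator modulo its `N`-part.**  `G` compact, `N ⊴ G` closed,
`t ∈ G` with `⟨t⟩N` dense, `λ : G →ₜ* ℤ_p` continuous (values in `Multiplicative ℤ_[p]`) and NOT trivial
on `N`.  Then for some `m ≥ 1` and `ι ∈ N` the element `φ = t ^ m ι⁻¹` lies in `ker λ` — so
`t ^ m = φ ι` — and `ker λ ≤ cl(⟨φ⟩ (ker λ ⊓ N))`.  Proof: `A = λ(N)` is a non-zero closed subgroup of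
`ℤ_p`, hence open; `U = λ⁻¹(A) = (ker λ) N` is an open normal subgroup containing `N`, so by the tree's
`exists_pow_mem_closure_inter_eq` (open subgroups of `cl(⟨t⟩N)`) `U = cl(⟨t^m⟩N)` with `t ^ m ∈ U`,
i.e. `λ(t^m) = λ(ι)`, `ι ∈ N`; then `⟨t^m⟩N = ⟨φ⟩N`, `ker λ ≤ U = cl(⟨φ⟩N)`, and the compactness
step `le_topologicalClosure_zpowers_sup_inf` finishes. [cite: RibesZalesskii2010, §2.7]
[cite: NeukirchSchmidtWingberg2008, Thm. 7.5.3] -/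
theorem exists_ker_le_topologicalClosure_zpowers_sup_inf {p : ℕ} [Fact p.Prime]
    (N : Subgroup G) [N.Normal] (hN : IsClosed (N : Set G)) (t : G)
    (ht : closure ((Subgroup.zpowers t ⊔ N : Subgroup G) : Set G) = Set.univ)
    (lam : G →ₜ* Multiplicative ℤ_[p]) (hlam : ∃ n ∈ N, lam n ≠ 1) :
    ∃ φ : G, lam φ = 1 ∧ (∃ m : ℕ, 0 < m ∧ ∃ ι ∈ N, t ^ m = φ * ι) ∧
      lam.toMonoidHom.ker ≤
        (Subgroup.zpowers φ ⊔ (lam.toMonoidHom.ker ⊓ N)).topologicalClosure := by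
  classical
  -- the image `A = λ(N)`, a closed non-trivial subgroup of `ℤ_p`, is open
  set A : Subgroup (Multiplicative ℤ_[p]) := N.map lam.toMonoidHom with hA_def
  have hNc : IsCompact (N : Set G) := hN.isCompact
  have hAc : IsClosed (A : Set (Multiplicative ℤ_[p])) := by
    have : (A : Set (Multiplicative ℤ_[p])) = lam '' (N : Set G) := by
      ext y; simp [hA_def]
    rw [this]
    exact (hNc.image lam.continuous).isClosed
  set A' : AddSubgroup ℤ_[p] := AddSubgroup.toSubgroup.symm A with hA'_def
  have hA'A : (A' : Set ℤ_[p]) = Multiplicative.ofAdd ⁻¹' (A : Set (Multiplicative ℤ_[p])) := by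
    ext z; rfl
  have hAA' : (A : Set (Multiplicative ℤ_[p])) = Multiplicative.toAdd ⁻¹' (A' : Set ℤ_[p]) := by
    ext z; rfl
  have hA'c : IsClosed (A' : Set ℤ_[p]) := by
    rw [hA'A]
    exact hAc.preimage continuous_ofAdd
  have hA'ne : A' ≠ ⊥ := by
    obtain ⟨n, hn, hn1⟩ := hlam
    intro h
    have hmem : (lam n).toAdd ∈ A' := by
      change Multiplicative.ofAdd (lam n).toAdd ∈ A
      rw [ofAdd_toAdd]
      exact ⟨n, hn, rfl⟩
    rw [h, AddSubgroup.mem_bot] at hmem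
    exact hn1 (Multiplicative.toAdd.injective (by rw [hmem, toAdd_one]))
  have hA'o : IsOpen (A' : Set ℤ_[p]) :=
    Literature.AnabelianGeometry.AbsoluteAnabelian.AbsTopIII.PadicInt.isOpen_of_isClosed_addSubgroup
      A' hA'c hA'ne
  have hAo : IsOpen (A : Set (Multiplicative ℤ_[p])) := by
    rw [hAA']
    exact hA'o.preimage continuous_toAdd
  -- the open normal subgroup `U = λ⁻¹(A) ⊇ N`
  set U : Subgroup G := A.comap lam.toMonoidHom with hU_def
  haveI hAn : A.Normal := inferInstance
  haveI hUn : U.Normal := Subgroup.Normal.comap hAn _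
  have hUo : IsOpen (U : Set G) := hAo.preimage lam.continuous
  have hNU : N ≤ U := fun n hn ↦ Subgroup.mem_comap.2 ⟨n, hn, rfl⟩
  -- open subgroups of `cl(⟨t⟩N)`
  obtain ⟨m, hm0, htm, hinter⟩ := exists_pow_mem_closure_inter_eq N t U hUo hNU
  rw [ht, Set.univ_inter] at hinter
  -- `λ(t^m) = λ(ι)` with `ι ∈ N`
  obtain ⟨ι, hιN, hι⟩ := Subgroup.mem_map.1 (Subgroup.mem_comap.1 htm)
  set φ : G := t ^ m * ι⁻¹ with hφ_def
  have hι' : lam ι = lam (t ^ m) := hι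
  have hφker : lam φ = 1 := by
    rw [hφ_def, map_mul, map_inv, ← hι', mul_inv_cancel]
  have htmφ : t ^ m = φ * ι := by rw [hφ_def]; group
  -- `⟨t^m⟩N = ⟨φ⟩N`
  have hsup : Subgroup.zpowers (t ^ m) ⊔ N = Subgroup.zpowers φ ⊔ N := by
    apply le_antisymm
    · refine sup_le ((Subgroup.zpowers_le).2 ?_) le_sup_right
      rw [htmφ]
      exact Subgroup.mul_mem _ (Subgroup.mem_sup_left (Subgroup.mem_zpowers φ))
        (Subgroup.mem_sup_right hιN)
    · refine sup_le ((Subgroup.zpowers_le).2 ?_) le_sup_right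
      rw [hφ_def]
      exact Subgroup.mul_mem _ (Subgroup.mem_sup_left (Subgroup.mem_zpowers (t ^ m)))
        (Subgroup.mem_sup_right (N.inv_mem hιN))
  rw [hsup] at hinter
  -- `ker λ ≤ U = cl(⟨φ⟩N)` and the compactness step
  have hKU : (lam.toMonoidHom.ker : Set G) ⊆ closure ((Subgroup.zpowers φ ⊔ N : Subgroup G) : Set G) := by
    rw [← hinter]
    intro x hx
    rw [SetLike.mem_coe, MonoidHom.mem_ker] at hx
    change x ∈ U
    rw [hU_def, Subgroup.mem_comap, hx]
    exact A.one_mem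
  have hKc : IsClosed ((lam.toMonoidHom.ker : Subgroup G) : Set G) := by
    have : ((lam.toMonoidHom.ker : Subgroup G) : Set G) = lam ⁻¹' {1} := by
      ext x; exact MonoidHom.mem_ker
    rw [this]
    exact isClosed_singleton.preimage lam.continuous
  have hφK : φ ∈ lam.toMonoidHom.ker := MonoidHom.mem_ker.2 hφker
  exact ⟨φ, hφker, ⟨m, hm0, ι, hιN, htmφ⟩,
    le_topologicalClosure_zpowers_sup_inf N hNc _ hKc hφK hKU⟩

end Literature.GroupTheory
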